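import Summits.MatrixMultiplication.MatrixMultiplication.Theorems.SoloInformedValTwoBlockFaces
import Summits.MatrixMultiplication.MatrixMultiplication.Theorems.SoloInformedValTwoBlockFacesB

/-!
# Two disjoint complete blocks: the triangle set is the union of the two boxes, `T = v₁ + v₂`

Solo-informed MatrixMultiplication, gen 77 (dossier `paper/val-superlinear.md` §15.8 (j)–(k)), a bookkeeping
complement to `SoloInformedValTwoBlockCriterion` / `SoloInformedValTwoBlockFaces`: for pair graphs
`blockPairs X₁ Y₁ X₂ Y₂`, `blockPairs Y₁ Z₁ Y₂ Z₂`, `blockPairs Z₁ X₁ Z₂ X₂` with `Y₁ ∩ Y₂ = ∅` and `Z₁ ∩ Z₂ = ∅` the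
triangles are exactly the triples of the two boxes (`triangleSet_blockPairs`), so with `X₁ ∩ X₂ = ∅` as well the
number of triangles is `|X₁||Y₁||Z₁| + |X₂||Y₂||Z₂|` (`card_triangleSet_blockPairs`).  Combined with the face
inequalities (`SoloInformedValTwoBlockFaces`, `SoloInformedValTwoBlockFacesB`): an accidental-free superlinear
union of two disjoint non-degenerate blocks has `|X₁| ≥ 2` (`NoAccidental.two_le_card_of_superlinear`) and in fact
every side of both blocks is at least two (`NoAccidental.two_le_cards_of_superlinear`) — thin blocks never pack
superlinearly, stated on the configuration itself.

Elementary; no `sorry`.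
-/

namespace Summit.MatrixMultiplication.MatrixMultiplication.Theorems.SoloVal

open Finset

section TwoBlockCount

variable {G : Type*} [AddCommGroup G] [DecidableEq G]
variable {X₁ Y₁ Z₁ X₂ Y₂ Z₂ : Finset G}

omit [AddCommGroup G] in
/-- With `Y₁ ∩ Y₂ = ∅` and `Z₁ ∩ Z₂ = ∅` the triangles of the two-block pair graphs are exactly the triples of the
two boxes `X₁ × Y₁ × Z₁ ∪ X₂ × Y₂ × Z₂`. -/
theorem triangleSet_blockPairs (hY : Disjoint Y₁ Y₂) (hZ : Disjoint Z₁ Z₂) :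
    triangleSet (blockPairs X₁ Y₁ X₂ Y₂) (blockPairs Y₁ Z₁ Y₂ Z₂) (blockPairs Z₁ X₁ Z₂ X₂) =
      X₁ ×ˢ Y₁ ×ˢ Z₁ ∪ X₂ ×ˢ Y₂ ×ˢ Z₂ := by
  ext ⟨i, j, k⟩
  rw [mem_triangleSet, IsTriangle, mem_blockPairs, mem_blockPairs, mem_blockPairs, Finset.mem_union,
    Finset.mem_product, Finset.mem_product, Finset.mem_product, Finset.mem_product]
  simp only
  have hY' : ∀ ⦃u⦄, u ∈ Y₁ → u ∈ Y₂ → False := fun u h1 h2 => Finset.disjoint_left.mp hY h1 h2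
  have hZ' : ∀ ⦃u⦄, u ∈ Z₁ → u ∈ Z₂ → False := fun u h1 h2 => Finset.disjoint_left.mp hZ h1 h2
  constructor
  · rintro ⟨hij | hij, hjk | hjk, hki | hki⟩
    · exact Or.inl ⟨hij.1, hij.2, hjk.2⟩
    · exact (hZ' hjk.2 hki.1).elim
    · exact (hY' hij.2 hjk.1).elim
    · exact (hY' hij.2 hjk.1).elim
    · exact (hY' hjk.1 hij.2).elim
    · exact (hY' hjk.1 hij.2).elim
    · exact (hZ' hki.1 hjk.2).elim
    · exact Or.inr ⟨hij.1, hij.2, hjk.2⟩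
  · rintro (⟨hi, hj, hk⟩ | ⟨hi, hj, hk⟩)
    · exact ⟨Or.inl ⟨hi, hj⟩, Or.inl ⟨hj, hk⟩, Or.inl ⟨hk, hi⟩⟩
    · exact ⟨Or.inr ⟨hi, hj⟩, Or.inr ⟨hj, hk⟩, Or.inr ⟨hk, hi⟩⟩

omit [AddCommGroup G] in
/-- `T = v₁ + v₂`: the number of triangles of two pairwise-disjoint complete blocks. -/
theorem card_triangleSet_blockPairs (hX : Disjoint X₁ X₂) (hY : Disjoint Y₁ Y₂) (hZ : Disjoint Z₁ Z₂) :
    (triangleSet (blockPairs X₁ Y₁ X₂ Y₂) (blockPairs Y₁ Z₁ Y₂ Z₂) (blockPairs Z₁ X₁ Z₂ X₂)).card =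
      X₁.card * Y₁.card * Z₁.card + X₂.card * Y₂.card * Z₂.card := by
  rw [triangleSet_blockPairs hY hZ]
  have hd : Disjoint (X₁ ×ˢ Y₁ ×ˢ Z₁) (X₂ ×ˢ Y₂ ×ˢ Z₂) := by
    rw [Finset.disjoint_left]
    rintro ⟨i, j, k⟩ h1 h2
    rw [Finset.mem_product] at h1 h2
    exact Finset.disjoint_left.mp hX h1.1 h2.1
  rw [Finset.card_union_of_disjoint hd, Finset.card_product, Finset.card_product, Finset.card_product,
    Finset.card_product, Nat.mul_assoc, Nat.mul_assoc]

/-- THIN BLOCKS NEVER PACK SUPERLINEARLY, stated on the configuration: if the union of two pairwise-disjoint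
complete blocks with `X₁, X₂` non-empty is accidental-free and has more triangles than `|G|`, then `|X₁| ≥ 2`
(and symmetrically for the other five classes). -/
theorem NoAccidental.two_le_card_of_superlinear [Fintype G]
    (hX : Disjoint X₁ X₂) (hY : Disjoint Y₁ Y₂) (hZ : Disjoint Z₁ Z₂) (hX₁ : X₁.Nonempty) (hX₂ : X₂.Nonempty)
    (hN : NoAccidental (id : G → G) id id (blockPairs X₁ Y₁ X₂ Y₂) (blockPairs Y₁ Z₁ Y₂ Z₂)
      (blockPairs Z₁ X₁ Z₂ X₂))
    (hT : Fintype.card G <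
      (triangleSet (blockPairs X₁ Y₁ X₂ Y₂) (blockPairs Y₁ Z₁ Y₂ Z₂) (blockPairs Z₁ X₁ Z₂ X₂)).card) :
    2 ≤ X₁.card := by
  rw [card_triangleSet_blockPairs hX hY hZ] at hT
  obtain ⟨t1, t2, -, -, -, -, c212, -⟩ := twoBlockAdditive_of_noAccidental hX hY hZ hN
  exact t1.two_le_card_of_superlinear t2 hX₁ hX₂ c212 hT

/-- EVERY SIDE OF A SUPERLINEAR TWO-BLOCK PAIR IS AT LEAST TWO (dossier §15.8 (k), all six face
inequalities combined): if the union of two disjoint complete blocks with non-empty sides is accidental-free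
and has more triangles than `|G|`, then `|X₁|, |Y₁|, |Z₁|, |X₂|, |Y₂|, |Z₂| ≥ 2`. -/
theorem NoAccidental.two_le_cards_of_superlinear [Fintype G]
    (hX : Disjoint X₁ X₂) (hY : Disjoint Y₁ Y₂) (hZ : Disjoint Z₁ Z₂)
    (hX₁ : X₁.Nonempty) (hY₁ : Y₁.Nonempty) (hZ₁ : Z₁.Nonempty)
    (hX₂ : X₂.Nonempty) (hY₂ : Y₂.Nonempty) (hZ₂ : Z₂.Nonempty)
    (hN : NoAccidental (id : G → G) id id (blockPairs X₁ Y₁ X₂ Y₂) (blockPairs Y₁ Z₁ Y₂ Z₂)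
      (blockPairs Z₁ X₁ Z₂ X₂))
    (hT : Fintype.card G <
      (triangleSet (blockPairs X₁ Y₁ X₂ Y₂) (blockPairs Y₁ Z₁ Y₂ Z₂) (blockPairs Z₁ X₁ Z₂ X₂)).card) :
    2 ≤ X₁.card ∧ 2 ≤ Y₁.card ∧ 2 ≤ Z₁.card ∧ 2 ≤ X₂.card ∧ 2 ≤ Y₂.card ∧ 2 ≤ Z₂.card := by
  rw [card_triangleSet_blockPairs hX hY hZ] at hT
  have hT' : Fintype.card G < X₂.card * Y₂.card * Z₂.card + X₁.card * Y₁.card * Z₁.card := by omega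
  obtain ⟨t1, t2, c112, c121, c122, c211, c212, c221⟩ := twoBlockAdditive_of_noAccidental hX hY hZ hN
  exact ⟨t1.two_le_card_of_superlinear t2 hX₁ hX₂ c212 hT,
    t2.two_le_card_Y_of_superlinear t1 hY₂ hY₁ c221 hT',
    t1.two_le_card_Z_of_superlinear t2 hZ₁ hZ₂ c122 hT,
    t2.two_le_card_of_superlinear t1 hX₂ hX₁ c121 hT',
    t1.two_le_card_Y_of_superlinear t2 hY₁ hY₂ c112 hT,
    t2.two_le_card_Z_of_superlinear t1 hZ₂ hZ₁ c211 hT'⟩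

end TwoBlockCount

end Summit.MatrixMultiplication.MatrixMultiplication.Theorems.SoloVal
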